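import Summits.AtomisticToContinuum.Crystallization.Theses.PricedLinkCensus
import Literature.MathematicalPhysics.StatisticalMechanics.LennardJonesClusters
import Literature.Barriers.AtomisticToContinuum.SutoDegenerateGroundStates

/-!
# `TruncatedCensusGap` / Negative: the `κ = 0` half is exactly periodic stability

Negative knowledge for crux `stmt-AtomisticToContinuum-14230`
(`PricedLinkCensus.TruncatedCensusGap`), crux-disprover seat g2 (2026-08-15).

`TruncatedCensusGap` asserts `N · e_χ* + κ · #charged ≤ E_χ(y)` for every finite injective
configuration `y`, with `e_χ* = ⨅_Q e_χ(Q)` the `Real.iInf` of the energy per particle of the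
range-2 truncated Lennard-Jones potential `V_χ = min 1 (max 0 (4 - 2r)) · V_LJ` over periodic
configurations.  This file certifies that the energy half of the inequality carries NO content
beyond bookkeeping:

* `energyPerParticle_eq_div_of_motif_eq` — **finite-range periodisation identity**: for a pair
  potential vanishing on `[R, ∞)`, a periodic configuration whose motif is an injective cluster
  `y` and whose non-zero periods are longer than `(mutual distances of y) + R` has energy per
  particle EXACTLY `E(y)/N`;
* `exists_periodic_energyPerParticle_eq` — such a periodisation exists (cubic period, the tree's
  `cubicLattice`), so `⨅_Q e(Q) ≤ E(y)/N` for every cluster once the range is bounded below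
  (`iInf_energyPerParticle_le_div`);
* `truncatedCensusGap_kappa_zero_iff_bddBelow` — the `κ = 0` shadow of the crux,
  `∀ y, N · e_χ* ≤ E_χ(y)`, is EQUIVALENT to `BddBelow (range e_χ)`; and the crux itself implies
  `BddBelow` (`truncatedCensusGap_bddBelow`), because otherwise `e_χ* = 0` by the `Real.iInf`
  convention and two points at distance `1` (energy `-1/12`) violate it.

Hence all the content of the crux is the defect price `κ > 0` (see the crux work file
`Cruxes/TruncatedCensusGap/Disproof.lean` for why that part resists refutation).  Nothing here
closes an item.
-/

noncomputable section

namespace Summit.AtomisticToContinuum.Crystallization.Theorems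

open Literature.MathematicalPhysics.StatisticalMechanics
open Literature.Barriers.AtomisticToContinuum (cubicLattice cubicBasis cubicBasis_apply)
open Summit.AtomisticToContinuum.Crystallization.Theses.PricedLinkCensus (TruncatedCensusGap)

/-! ## The cubic lattice `cℤ³`: coordinates and the length of non-zero vectors -/

/-- Coordinates of vectors of the cubic lattice `cℤ³` are integer multiples of `c`. [folklore] -/
theorem exists_apply_eq_mul_int_of_mem_cubicLattice {c : ℝˣ} {g : EuclideanSpace ℝ (Fin 3)}
    (hg : g ∈ cubicLattice c) (i : Fin 3) : ∃ n : ℤ, g i = (c : ℝ) * n := by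
  unfold Literature.Barriers.AtomisticToContinuum.cubicLattice at hg
  induction hg using Submodule.span_induction with
  | mem x hx =>
    obtain ⟨j, rfl⟩ := hx
    refine ⟨if i = j then 1 else 0, ?_⟩
    rw [cubicBasis_apply]
    split_ifs with hij
    · subst hij; simp
    · simp [hij]
  | zero => exact ⟨0, by simp⟩
  | add x x' _ _ hx hx' =>
    obtain ⟨m, hm⟩ := hx
    obtain ⟨n, hn⟩ := hx'
    exact ⟨m + n, by simp [hm, hn]; ring⟩
  | smul a x _ hx =>
    obtain ⟨m, hm⟩ := hx
    refine ⟨a * m, ?_⟩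
    rw [← Int.cast_smul_eq_zsmul ℝ a x]
    simp [hm]
    ring

/-- Non-zero vectors of `cℤ³` (`c > 0`) have norm at least `c`. [folklore] -/
theorem le_norm_of_mem_cubicLattice_of_ne_zero {c : ℝˣ} (hc : 0 < (c : ℝ))
    {g : EuclideanSpace ℝ (Fin 3)} (hg : g ∈ cubicLattice c) (hg0 : g ≠ 0) : (c : ℝ) ≤ ‖g‖ := by
  obtain ⟨i, hi⟩ : ∃ i, g i ≠ 0 := by
    by_contra h
    simp only [not_exists, not_not] at h
    exact hg0 (PiLp.ext h)
  obtain ⟨n, hn⟩ := exists_apply_eq_mul_int_of_mem_cubicLattice hg i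
  have hn0 : n ≠ 0 := by
    rintro rfl
    simp [hn] at hi
  have h1 : (1 : ℝ) ≤ |(n : ℝ)| := by exact_mod_cast Int.one_le_abs hn0
  calc (c : ℝ) ≤ (c : ℝ) * |(n : ℝ)| := le_mul_of_one_le_right hc.le h1
    _ = ‖g i‖ := by rw [hn, Real.norm_eq_abs, abs_mul, abs_of_pos hc]
    _ ≤ ‖g‖ := PiLp.norm_apply_le g i

/-! ## The finite-range periodisation identity -/

/-- In a periodic configuration whose motif is the injective cluster `y` and whose non-zero
periods are at least `(mutual distances) + R` long, a point of the cluster sees, within the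
range `R` of a potential `V` vanishing on `[R, ∞)`, only the other points of its own copy: the
inner lattice sum of `energyPerParticle` is the finite site energy. [folklore] -/
theorem tsum_eq_siteEnergy_of_motif_eq {V : ℝ → ℝ} {R : ℝ} (hV : ∀ r, R ≤ r → V r = 0)
    {N : ℕ} {y : Fin N → EuclideanSpace ℝ (Fin 3)} (hy : Function.Injective y)
    (P : PeriodicConfiguration 3) (hmotif : P.motif = Finset.univ.image y)
    (hfar : ∀ g ∈ P.lattice, g ≠ 0 → ∀ i j, ‖y i - y j‖ + R ≤ ‖g‖) (i : Fin N) :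
    (∑' z : {z : EuclideanSpace ℝ (Fin 3) // z ∈ P.points ∧ z ≠ y i}, V (dist (y i) z.1)) =
      siteEnergy V y i := by
  classical
  have hmem : ∀ j : Fin N, j ≠ i → (y j ∈ P.points ∧ y j ≠ y i) := fun j hji =>
    ⟨P.mem_points_of_mem_motif (hmotif ▸ Finset.mem_image_of_mem y (Finset.mem_univ j)),
      fun h => hji (hy h)⟩
  -- the other sites of the cluster, embedded into the index type of the lattice sum
  let emb : {j // j ∈ Finset.univ.erase i} ↪
      {z : EuclideanSpace ℝ (Fin 3) // z ∈ P.points ∧ z ≠ y i} :=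
    ⟨fun j => ⟨y j.1, hmem j.1 (Finset.ne_of_mem_erase j.2)⟩, fun j k h =>
      Subtype.ext (hy (congrArg Subtype.val h))⟩
  rw [tsum_eq_sum (s := (Finset.univ.erase i).attach.map emb) ?_]
  · rw [Finset.sum_map]
    exact Finset.sum_attach (Finset.univ.erase i) (fun j => V (dist (y i) (y j)))
  · intro z hz
    obtain ⟨x, hx, g, hg, hz'⟩ := z.2.1
    rw [hmotif] at hx
    obtain ⟨j, -, rfl⟩ := Finset.mem_image.1 hx
    have hg0 : g ≠ 0 := by
      rintro rfl
      apply hz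
      have hji : j ≠ i := by
        rintro rfl
        exact z.2.2 (by rw [hz', add_zero])
      rw [Finset.mem_map]
      exact ⟨⟨j, Finset.mem_erase.2 ⟨hji, Finset.mem_univ j⟩⟩, Finset.mem_attach _ _,
        Subtype.ext (by rw [hz', add_zero]; rfl)⟩
    apply hV
    have hgL := hfar g hg hg0 j i
    have h1 : ‖g‖ ≤ ‖g + (y j - y i)‖ + ‖y j - y i‖ := by
      simpa using norm_sub_le (g + (y j - y i)) (y j - y i)
    have h2 : dist (y i) z.1 = ‖g + (y j - y i)‖ := by
      rw [hz', dist_eq_norm, ← norm_neg]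
      congr 1
      abel
    linarith

/-- **Finite-range periodisation identity.** For a pair potential `V` vanishing on `[R, ∞)`, a
periodic configuration of `ℝ³` whose motif is an injective `N`-point cluster `y` (`N ≥ 1`) and
whose non-zero periods are at least `(mutual distances of y) + R` long has energy per particle
exactly `E(y)/N`, `E = interactionEnergy V`. [folklore] -/
theorem energyPerParticle_eq_div_of_motif_eq {V : ℝ → ℝ} {R : ℝ} (hV : ∀ r, R ≤ r → V r = 0)
    {N : ℕ} {y : Fin N → EuclideanSpace ℝ (Fin 3)} (hy : Function.Injective y)
    (P : PeriodicConfiguration 3) (hmotif : P.motif = Finset.univ.image y)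
    (hfar : ∀ g ∈ P.lattice, g ≠ 0 → ∀ i j, ‖y i - y j‖ + R ≤ ‖g‖) :
    P.energyPerParticle V = interactionEnergy V y / N := by
  have hN : 0 < N := by
    obtain ⟨x, hx⟩ := P.motif_nonempty
    rw [hmotif] at hx
    obtain ⟨i, -, -⟩ := Finset.mem_image.1 hx
    exact i.pos
  have hcard : P.motif.card = N := by
    rw [hmotif, Finset.card_image_of_injective _ hy, Finset.card_univ, Fintype.card_fin]
  have hsum : (∑ x ∈ P.motif,
      ∑' z : {z : EuclideanSpace ℝ (Fin 3) // z ∈ P.points ∧ z ≠ x}, V (dist x z.1)) =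
        2 * interactionEnergy V y := by
    rw [hmotif, Finset.sum_image (fun j _ k _ h => hy h), two_mul_interactionEnergy]
    exact Finset.sum_congr rfl fun i _ => tsum_eq_siteEnergy_of_motif_eq hV hy P hmotif hfar i
  unfold PeriodicConfiguration.energyPerParticle
  rw [hcard, hsum]
  have hN' : (N : ℝ) ≠ 0 := by exact_mod_cast hN.ne'
  field_simp

/-- **Cubic periodisation exists.** For a pair potential vanishing on `[R, ∞)` and an injective
`N`-point cluster `y` (`N ≥ 1`) there is a periodic configuration of `ℝ³` (lattice `Lℤ³`,
`L = |R| + 1 + 2 Σ_k ‖y_k‖`, motif = the cluster) with energy per particle `E(y)/N`. [folklore] -/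
theorem exists_periodic_energyPerParticle_eq {V : ℝ → ℝ} {R : ℝ} (hV : ∀ r, R ≤ r → V r = 0)
    {N : ℕ} {y : Fin N → EuclideanSpace ℝ (Fin 3)} (hy : Function.Injective y) (hN : 0 < N) :
    ∃ P : PeriodicConfiguration 3, P.motif = Finset.univ.image y ∧
      P.energyPerParticle V = interactionEnergy V y / N := by
  set L : ℝ := |R| + 1 + 2 * ∑ k, ‖y k‖ with hL_def
  have hS : 0 ≤ ∑ k, ‖y k‖ := Finset.sum_nonneg fun k _ => norm_nonneg (y k)
  have hL : 0 < L := by positivity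
  have hyS : ∀ i j, ‖y i - y j‖ ≤ 2 * ∑ k, ‖y k‖ := by
    intro i j
    have hi : ‖y i‖ ≤ ∑ k, ‖y k‖ :=
      Finset.single_le_sum (fun k _ => norm_nonneg (y k)) (Finset.mem_univ i)
    have hj : ‖y j‖ ≤ ∑ k, ‖y k‖ :=
      Finset.single_le_sum (fun k _ => norm_nonneg (y k)) (Finset.mem_univ j)
    linarith [norm_sub_le (y i) (y j)]
  let P : PeriodicConfiguration 3 :=
    { lattice := cubicLattice (Units.mk0 L hL.ne')
      discrete := inferInstance
      isZLattice := inferInstance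
      motif := Finset.univ.image y
      motif_nonempty := by
        haveI : Nonempty (Fin N) := ⟨⟨0, hN⟩⟩
        exact Finset.univ_nonempty.image y
      eq_of_sub_mem := by
        intro x hx x' hx' hsub
        obtain ⟨i, -, rfl⟩ := Finset.mem_image.1 hx
        obtain ⟨j, -, rfl⟩ := Finset.mem_image.1 hx'
        by_contra hne
        have h := le_norm_of_mem_cubicLattice_of_ne_zero (c := Units.mk0 L hL.ne') hL hsub
          (sub_ne_zero.2 hne)
        simp only [Units.val_mk0] at h
        linarith [hyS i j, abs_nonneg R] }
  refine ⟨P, rfl, energyPerParticle_eq_div_of_motif_eq hV hy P rfl ?_⟩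
  intro g hg hg0 i j
  have h := le_norm_of_mem_cubicLattice_of_ne_zero (c := Units.mk0 L hL.ne') hL hg hg0
  simp only [Units.val_mk0] at h
  linarith [hyS i j, le_abs_self R]

/-- **Trial-state bound for finite-range potentials.** If the energy per particle of periodic
configurations is bounded below, then `⨅_Q e(Q) ≤ E(y)/N` for every injective `N`-point
cluster, `N ≥ 1`. [folklore] -/
theorem iInf_energyPerParticle_le_div {V : ℝ → ℝ} {R : ℝ} (hV : ∀ r, R ≤ r → V r = 0)
    (hB : BddBelow (Set.range fun Q : PeriodicConfiguration 3 => Q.energyPerParticle V))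
    {N : ℕ} {y : Fin N → EuclideanSpace ℝ (Fin 3)} (hy : Function.Injective y) (hN : 0 < N) :
    (⨅ Q : PeriodicConfiguration 3, Q.energyPerParticle V) ≤ interactionEnergy V y / N := by
  obtain ⟨P, -, hP⟩ := exists_periodic_energyPerParticle_eq hV hy hN
  rw [← hP]
  exact ciInf_le hB P

/-! ## Specialisation to the truncated Lennard-Jones potential of the crux -/

/-- The range-2 truncated Lennard-Jones potential vanishes on `[2, ∞)`. [folklore] -/
theorem truncLJ_eq_zero_of_two_le (r : ℝ) (hr : 2 ≤ r) :
    min 1 (max 0 (4 - 2 * r)) * lennardJones r = 0 := by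
  have h : max 0 (4 - 2 * r) = 0 := max_eq_left (by linarith)
  simp [h]

/-- Two points at distance `1` have truncated energy `-1/12` (the truncation is invisible up to
`r = 3/2`, `V_LJ 1 = -1/12`, and the junk diagonal `V 0 = 0`). [folklore] -/
theorem interactionEnergy_truncLJ_pair :
    interactionEnergy (fun r => min 1 (max 0 (4 - 2 * r)) * lennardJones r)
      ![(0 : EuclideanSpace ℝ (Fin 3)), EuclideanSpace.single 0 1] = -1 / 12 := by
  have h0 : (fun r : ℝ => min 1 (max 0 (4 - 2 * r)) * lennardJones r) 0 = 0 := by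
    simp [lennardJones_zero]
  have h2 := two_mul_interactionEnergy_eq_sum_sum
    (fun r : ℝ => min 1 (max 0 (4 - 2 * r)) * lennardJones r) h0
    ![(0 : EuclideanSpace ℝ (Fin 3)), EuclideanSpace.single 0 1]
  have hd : dist (0 : EuclideanSpace ℝ (Fin 3)) (EuclideanSpace.single 0 1) = 1 := by
    rw [dist_comm, dist_zero_right]
    simp
  have hmin : min (1 : ℝ) (max 0 (4 - 2 * 1)) = 1 := by norm_num
  simp only [Fin.sum_univ_two, Matrix.cons_val_zero, Matrix.cons_val_one, dist_self,
    dist_comm _ (0 : EuclideanSpace ℝ (Fin 3)), hd, lennardJones_zero, lennardJones_one,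
    hmin, mul_zero] at h2
  linarith

/-- The two-point configuration `{0, e₀}` is injective. [folklore] -/
theorem injective_pair_zero_single :
    Function.Injective ![(0 : EuclideanSpace ℝ (Fin 3)), EuclideanSpace.single 0 1] := by
  have hne : (0 : EuclideanSpace ℝ (Fin 3)) ≠ EuclideanSpace.single 0 1 := by
    intro h
    have := congrArg (fun v : EuclideanSpace ℝ (Fin 3) => v 0) h
    simp at this
  intro i j hij
  match i, j with
  | ⟨0, _⟩, ⟨0, _⟩ => rfl
  | ⟨0, _⟩, ⟨1, _⟩ => exact (hne hij).elim
  | ⟨1, _⟩, ⟨0, _⟩ => exact (hne hij.symm).elim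
  | ⟨1, _⟩, ⟨1, _⟩ => rfl

/-- **The `κ = 0` shadow of `TruncatedCensusGap` is equivalent to periodic stability of
`V_χ`.** (`→`: if the range were not bounded below, `e_χ* = 0` by `Real.iInf_of_not_bddBelow`
and the pair `{0, e₀}` has energy `-1/12 < 0`; `←`: cubic periodisation.) [folklore] -/
theorem truncatedCensusGap_kappa_zero_iff_bddBelow :
    (∀ (N : ℕ) (y : Fin N → EuclideanSpace ℝ (Fin 3)), Function.Injective y →
      (N : ℝ) * (⨅ Q : PeriodicConfiguration 3,
        Q.energyPerParticle (fun r => min 1 (max 0 (4 - 2 * r)) * lennardJones r)) ≤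
      interactionEnergy (fun r => min 1 (max 0 (4 - 2 * r)) * lennardJones r) y) ↔
    BddBelow (Set.range fun Q : PeriodicConfiguration 3 =>
      Q.energyPerParticle (fun r => min 1 (max 0 (4 - 2 * r)) * lennardJones r)) := by
  constructor
  · intro h
    by_contra hB
    have h2 := h 2 _ injective_pair_zero_single
    rw [Real.iInf_of_not_bddBelow hB, interactionEnergy_truncLJ_pair] at h2
    norm_num at h2
  · intro hB N y hy
    rcases Nat.eq_zero_or_pos N with rfl | hN
    · simp [interactionEnergy]
    · have h := iInf_energyPerParticle_le_div truncLJ_eq_zero_of_two_le hB hy hN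
      rwa [le_div_iff₀ (by exact_mod_cast hN), mul_comm] at h

/-- **`TruncatedCensusGap` implies periodic stability of `V_χ`** (so a proof must land
`BddBelow (range e_χ)` first; without it the `Real.iInf` is the junk value `0` and the pair
`{0, e₀}` refutes the inequality). [folklore] -/
theorem truncatedCensusGap_bddBelow (h : TruncatedCensusGap) :
    BddBelow (Set.range fun Q : PeriodicConfiguration 3 =>
      Q.energyPerParticle (fun r => min 1 (max 0 (4 - 2 * r)) * lennardJones r)) := by
  obtain ⟨κ, hκ, h⟩ := h
  by_contra hB
  have h2 := h 2 _ injective_pair_zero_single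
  rw [Real.iInf_of_not_bddBelow hB, interactionEnergy_truncLJ_pair] at h2
  have : (0 : ℝ) ≤ κ * (Nat.card {i : Fin 2 // ¬ Literature.Geometry.DiscreteGeometry.IsChargeFree
      (1 / 100 : ℝ) ![(0 : EuclideanSpace ℝ (Fin 3)), EuclideanSpace.single 0 1] i} : ℝ) :=
    mul_nonneg hκ.le (Nat.cast_nonneg _)
  norm_num at h2
  linarith

/-- **The energy half of `TruncatedCensusGap` is free**: the crux implies its own `κ = 0`
shadow, which by `truncatedCensusGap_kappa_zero_iff_bddBelow` is mere periodic stability; all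
content of the crux is the price `κ > 0` of a charged site. [folklore] -/
theorem truncatedCensusGap_kappa_zero (h : TruncatedCensusGap) (N : ℕ)
    (y : Fin N → EuclideanSpace ℝ (Fin 3)) (hy : Function.Injective y) :
    (N : ℝ) * (⨅ Q : PeriodicConfiguration 3,
        Q.energyPerParticle (fun r => min 1 (max 0 (4 - 2 * r)) * lennardJones r)) ≤
      interactionEnergy (fun r => min 1 (max 0 (4 - 2 * r)) * lennardJones r) y :=
  truncatedCensusGap_kappa_zero_iff_bddBelow.2 (truncatedCensusGap_bddBelow h) N y hy

end Summit.AtomisticToContinuum.Crystallization.Theorems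

end
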